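import Summits.CriticalPhenomena.CardyFormulaZ2.Theorems.CardyBoundaryCoulombGasStripClusterRatesRectBoxExists
import Summits.CriticalPhenomena.CardyFormulaZ2.Theorems.CardyBoundaryCoulombGasStripClusterRatesRectBoxDictionary
import Summits.CriticalPhenomena.CardyFormulaZ2.Theorems.CardyBoundaryCoulombGasStripClusterRatesRectCardyOneOfParts
import Summits.CriticalPhenomena.CardyFormulaZ2.Theorems.CardyBoundaryCoulombGasStripClusterRatesStubComposeOne
import Summits.CriticalPhenomena.CardyFormulaZ2.Theorems.CardyBoundaryCoulombGasStripClusterRatesStubSandwichUpper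
import Summits.CriticalPhenomena.CardyFormulaZ2.Theorems.CardyBoundaryCoulombGasStripClusterRatesStubLamRLog
import Summits.CriticalPhenomena.CardyFormulaZ2.Theorems.CardyBoundaryCoulombGasStripClusterRatesStubCardyLog
import Summits.CriticalPhenomena.CardyFormulaZ2.Theorems.CardyBoundaryCoulombGasStripClusterRatesReduction

/-!
# `StripClusterRates` from crux 4 and the two-cluster Kac asymptotics alone

Support file for line `two-cluster-rate-is-stationary-gap` (crux `StripClusterRates`,
stmt-CriticalPhenomena-13878), lead c3. With the γ₁-half a corollary of crux 4 (lead -1's landed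
`stub_composeOne` chain fed with `rc_rectCardyOne_of_parts rc_exists_boxRect rc_box_dictionary`; packaged as
`oneClusterKac_of_rectilinearCardy` in the sibling file `…RectCardyOneOfRectilinearCardy`) and the landed RateIsGap
theorems (`oneClusterRate_eq_escapeRate`, `twoClusterRate_eq_relaxationRate`, file `…Reduction`), the crux
follows from the route's crux 4 `RectilinearCardy` (stmt-CriticalPhenomena-5660) and ONE spectral statement,
the registered stub `stub_kacTwo` of lead -1 (= the skeleton's `RelaxationRateKac`, inlined):
`n·(−log SLEM of the unmarked block of planarTransfer (Icc 0 n)) → 2π`. This is the registered sub-goal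
`stripClusterRates_of_rectilinearCardy_of_kacTwo`; it records that everything in the crux beyond crux 4 is
the `h_{1,5} = 2` gap of the two-cluster sector (open: Cardy 1998 eq. (bb), n = 2). No definitions are
introduced.
-/

noncomputable section

namespace Summit.CriticalPhenomena.CardyFormulaZ2.Cruxes.StripClusterRates.TwoClusterRateIsStationaryGap

open Filter Topology
open Literature.Probability.Percolation Literature.Probability.LatticeModels

/-- **`StripClusterRates` ⟸ crux 4 ∧ K₂.** If Cardy's formula holds for rectilinear conformal rectangles
(`RectilinearCardy`, crux 4 of the route) and the relaxation moduli `s(n)` of the stationary connectivity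
chains have the Kac asymptotics `n·(−log s(n)) → 2π` (registered stub `stub_kacTwo`, inlined verbatim), then
the crux `StripClusterRates` holds: the rates are chosen from the landed RateIsGap theorems, `n·γ₁(n) → π/3`
is lead -1's landed sandwich composition `stub_composeOne` (fed with the landed `stub_sandwichUpper`, `stub_lamRLog`, `stub_cardyLog`
and `rc_rectCardyOne_of_parts rc_exists_boxRect rc_box_dictionary h₄`), and `n·γ₂(n) → 2π` is the hypothesis applied to
`s(n) = e^{−γ₂(n)}`.
[cite: Cardy1998, eq. (bb)] -/
theorem stripClusterRates_of_rectilinearCardy_of_kacTwo :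
    Summit.CriticalPhenomena.CardyFormulaZ2.Theses.CardyBoundaryCoulombGas.RectilinearCardy →
    (∀ s : ℕ → ℝ,
      (∀ n : ℕ, 1 ≤ n →
        ((∃ (μ : ℂ) (v : PlanarRowState (Finset.Icc (0 : ℤ) n) → ℂ),
          (v ≠ 0 ∧ (∀ p, (∃ x, p.1.JoinedToStar x) → v p = 0) ∧
            ∀ p, (∀ x, ¬ p.1.JoinedToStar x) →
              ∑ q, (planarTransfer (Finset.Icc (0 : ℤ) n) p q : ℂ) * v q = μ * v p) ∧
          μ ≠ 1 ∧ ‖μ‖ = s n) ∧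
        ∀ (μ : ℂ) (v : PlanarRowState (Finset.Icc (0 : ℤ) n) → ℂ),
          (v ≠ 0 ∧ (∀ p, (∃ x, p.1.JoinedToStar x) → v p = 0) ∧
            ∀ p, (∀ x, ¬ p.1.JoinedToStar x) →
              ∑ q, (planarTransfer (Finset.Icc (0 : ℤ) n) p q : ℂ) * v q = μ * v p) →
          μ ≠ 1 → ‖μ‖ ≤ s n)) →
      Tendsto (fun n : ℕ ↦ (n : ℝ) * -Real.log (s n)) atTop (𝓝 (2 * Real.pi))) →
    Summit.CriticalPhenomena.CardyFormulaZ2.Theses.CardyBoundaryCoulombGas.StripClusterRates := by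
  intro h₄ hK₂
  have h₁ := oneClusterRate_eq_escapeRate
  have h₂ := twoClusterRate_eq_relaxationRate
  let γ₁ : ℕ → ℝ := fun n => if hn : 1 ≤ n then (h₁ n hn).choose else 0
  let γ₂ : ℕ → ℝ := fun n => if hn : 1 ≤ n then (h₂ n hn).choose else 0
  have hγ₁ : ∀ n : ℕ, ∀ hn : 1 ≤ n, γ₁ n = (h₁ n hn).choose := fun n hn => dif_pos hn
  have hγ₂ : ∀ n : ℕ, ∀ hn : 1 ≤ n, γ₂ n = (h₂ n hn).choose := fun n hn => dif_pos hn
  have hrate₁ : ∀ n : ℕ, 1 ≤ n →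
      Tendsto (fun m : ℕ ↦ -Real.log (crossingProb half m n) / (m : ℝ)) atTop (𝓝 (γ₁ n)) := by
    intro n hn
    rw [hγ₁ n hn]
    exact (h₁ n hn).choose_spec.1
  refine ⟨γ₁, γ₂, hrate₁, ?_, ?_, ?_⟩
  · intro n hn
    rw [hγ₂ n hn]
    exact (h₂ n hn).choose_spec.1
  · exact stub_composeOne stub_sandwichUpper stub_lamRLog stub_cardyLog
      (rc_rectCardyOne_of_parts rc_exists_boxRect rc_box_dictionary h₄) γ₁ hrate₁
  · have h := hK₂ (fun n => Real.exp (-γ₂ n)) (fun n hn => by rw [hγ₂ n hn]; exact (h₂ n hn).choose_spec.2)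
    refine h.congr' (Eventually.of_forall fun n => ?_)
    exact red_mul_neg_log_exp_neg n (γ₂ n)

end Summit.CriticalPhenomena.CardyFormulaZ2.Cruxes.StripClusterRates.TwoClusterRateIsStationaryGap

end
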